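import Mathlib.Tactic
import Mathlib.Algebra.Order.Floor.Defs
import HarnessLib
import Summits.CriticalPhenomena.PercolationContinuityZ3.Theorems.PercNearOneGluingNoHeavyLowerTailQuantitativeAntitheticTowerChain

/-!
# (DC+) at the end of a long arm against an arbitrary core — the unconditional arithmetic (PROOFS §P72 (g); BENCH M2-R115)

Support file (`--supports stmt-CriticalPhenomena-4575`), prover seat `prim-rate-mine-2` (lane prim-rate, constants-miner (c);
`run/shared/lean/prim/prim-rate/prim-rate-mine-2/PROOFS.md` §P72 (f), (g)).  No definitions, no named facts, no sorries; standard axioms.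

SETTING.  One-arm graph `G_k` = arbitrary core `Q` (containing `a`, `u` and the hub's neighbours) + hub–path arm of length `k` attached at a core
vertex `c`, terminal `b` at the arm's end; arm lemma `C₀ = a₀ + βk`, `S = s₀ + σk`; (DC+) margin at the arm's end pair `= 2[β + σ·C(n) + Δ(s₀ + σ(k−1))]`,
`n = k + n_Q + 1`, `K := n − 2 = k + r` with `r = n_Q − 1`.  PROOFS §P72 (g) proves the CORE SIZE LEMMA (CSL′) `−β ≤ (κ − 1)σ` (`κ` = the number of
vertices of `u`'s component of `Q − c`, `κ ≤ r`) for EVERY core, by the (aK4b) induction at the pairs containing `c` with a key lemma established by three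
explicit injections; PROOFS §P72 (f3) proves `s₀ ≥ A⁺`, whence `s₀ + β − σ ≥ −σ`.  With the virtual side counts `λ* = σ`, `φ* = σ − β ≤ κλ*`,
`ν* = s₀ + β − σ ≥ −λ*` the margin is `λ*(1 + c + Δ(k−1)) − φ*(1−Δ) + Δν* ≥ λ*(1 + c + Δ(k−2)) − φ*(1−Δ)`, and this file proves that the right-hand side is
non-negative as soon as the arm is two longer than `u`'s component: `k ≥ κ + 2`.

* `CSH.dcplus_armSide_margin_nonneg_weak` — `λ ≥ 0`, `φ ≤ κλ`, `κ ≤ r`, `k ≥ κ + 2`, `K = k + r ≥ 5` ⟹ `0 ≤ λ(1 + c K + Δ(k−2)) − φ(1 − Δ)`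
  (`Δ = c K − c (K−1)`; from `CSH.sizeLawConst_recursion` and `CSH.sizeLawConst_delta_lt_third`).
* `CSH.dcplus_oneArm_margin_nonneg_unconditional` — the margin `β + σ·c K + Δ(s₀ + σ(k−1)) ≥ 0` from `σ ≥ 0`, (CSL′) `−β ≤ (κ−1)σ`,
  `s₀ + β − σ ≥ −σ` (i.e. `s₀ + β ≥ 0`), `κ ≤ r`, `k ≥ κ + 2`: (DC+) at the end of every arm of length `≥ κ_c + 2` against an arbitrary core.
[cite: VandenbergHaggstromKahn2005, Thm. 1.3 (p. 6)] [cite: Harris1960, Lemma 4.1 (p. 16)]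
-/

namespace Summit.CriticalPhenomena.PercolationContinuityZ3.Theorems.CSH

/-- **Arm one shorter, no `ν`-term** (PROOFS §P72 (g)): with `K = k + r ≥ 5`, `c = c K`, `Δ = c K − c (K−1)`, `λ ≥ 0`, `φ ≤ κ·λ`, `κ ≤ r` and `k ≥ κ + 2`:
`0 ≤ λ·(1 + c + Δ·(k − 2)) − φ·(1 − Δ)`.  (The bracket is `≥ λ[⌊K/2⌋ − κ − Δ(r + 1 − κ)] ≥ 0` by the recursion `1 + c + Δ(K−1) = ⌊K/2⌋` and `Δ < 1/3`.)
[cite: VandenbergHaggstromKahn2005, Thm. 1.3 (p. 6)] -/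
theorem dcplus_armSide_margin_nonneg_weak (K k r κ : ℕ) (hK : 5 ≤ K) (hsum : k + r = K) (hκr : κ ≤ r) (hkκ : κ + 2 ≤ k)
    (lam φ : ℚ) (hlam : 0 ≤ lam) (hφ : φ ≤ κ * lam) :
    0 ≤ lam * (1 + ((((K ^ 2 / 4 : ℕ) : ℚ) / K - 1))
          + ((((K ^ 2 / 4 : ℕ) : ℚ) / K - 1) - ((((K - 1) ^ 2 / 4 : ℕ) : ℚ) / ((K - 1 : ℕ) : ℚ) - 1)) * ((k : ℚ) - 2))
        - φ * (1 - ((((K ^ 2 / 4 : ℕ) : ℚ) / K - 1) - ((((K - 1) ^ 2 / 4 : ℕ) : ℚ) / ((K - 1 : ℕ) : ℚ) - 1))) := by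
  have hrec := sizeLawConst_recursion K hK
  obtain ⟨hΔ0, hΔ3⟩ := sizeLawConst_delta_lt_third K hK
  have hK1 : ((K - 1 : ℕ) : ℚ) = K - 1 := by rw [Nat.cast_sub (by omega : 1 ≤ K)]; push_cast; ring
  rw [hK1] at hrec hΔ0 hΔ3 ⊢
  set c : ℚ := (((K ^ 2 / 4 : ℕ) : ℚ) / K - 1) with hc
  set Δ : ℚ := c - ((((K - 1) ^ 2 / 4 : ℕ) : ℚ) / ((K : ℚ) - 1) - 1) with hΔ
  have hfloor : ((K : ℚ) - 1) / 2 ≤ ((K / 2 : ℕ) : ℚ) := by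
    have h : K ≤ 2 * (K / 2) + 1 := by omega
    have : (K : ℚ) ≤ 2 * ((K / 2 : ℕ) : ℚ) + 1 := by exact_mod_cast h
    linarith
  have hKq : (K : ℚ) = k + r := by rw [← hsum]; push_cast; ring
  have hkκq : (κ : ℚ) + 2 ≤ k := by exact_mod_cast hkκ
  have hκrq : (κ : ℚ) ≤ r := by exact_mod_cast hκr
  have h1Δ : 0 ≤ 1 - Δ := by linarith
  have hφ' : φ * (1 - Δ) ≤ κ * lam * (1 - Δ) := mul_le_mul_of_nonneg_right hφ h1Δ
  have hcore : 0 ≤ 1 + c + Δ * ((k : ℚ) - 2) - κ * (1 - Δ) := by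
    have e1 : 1 + c = ((K / 2 : ℕ) : ℚ) - Δ * ((K : ℚ) - 1) := by linarith
    rw [e1, hKq]
    rw [hKq] at hfloor
    nlinarith [hΔ0, hΔ3, hkκq, hκrq, hfloor]
  have : 0 ≤ lam * (1 + c + Δ * ((k : ℚ) - 2) - κ * (1 - Δ)) := mul_nonneg hlam hcore
  nlinarith [this, hφ']

/-- **(DC+) at the end of every arm of length `≥ κ_c + 2` against an ARBITRARY core — the arithmetic, with the core size lemma and the bound
`s₀ + β ≥ 0` (both THEOREMS, PROOFS §P72 (g), (f3)) as hypotheses**: `0 ≤ β + σ·c K + Δ·(s₀ + σ(k−1))`.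
(Apply `CSH.dcplus_armSide_margin_nonneg_weak` to `(λ, φ) := (σ, σ − β)`.) [cite: VandenbergHaggstromKahn2005, Thm. 1.3 (p. 6)] -/
theorem dcplus_oneArm_margin_nonneg_unconditional (K k r κ : ℕ) (hK : 5 ≤ K) (hsum : k + r = K) (hκr : κ ≤ r) (hkκ : κ + 2 ≤ k)
    (β σ s₀ : ℚ) (hσ : 0 ≤ σ) (hCSL : -β ≤ (κ - 1 : ℚ) * σ) (hs : 0 ≤ s₀ + β) :
    0 ≤ β + σ * ((((K ^ 2 / 4 : ℕ) : ℚ) / K - 1))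
        + ((((K ^ 2 / 4 : ℕ) : ℚ) / K - 1) - ((((K - 1) ^ 2 / 4 : ℕ) : ℚ) / ((K - 1 : ℕ) : ℚ) - 1)) * (s₀ + σ * ((k : ℚ) - 1)) := by
  have h := dcplus_armSide_margin_nonneg_weak K k r κ hK hsum hκr hkκ σ (σ - β) hσ (by linarith)
  obtain ⟨hΔ0, _⟩ := sizeLawConst_delta_lt_third K hK
  set c : ℚ := (((K ^ 2 / 4 : ℕ) : ℚ) / K - 1) with hc
  set Δ : ℚ := c - ((((K - 1) ^ 2 / 4 : ℕ) : ℚ) / ((K - 1 : ℕ) : ℚ) - 1) with hΔ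
  -- margin = [σ(1+c+Δ(k-2)) - (σ-β)(1-Δ)] + Δ(s₀ + β)
  have key : β + σ * c + Δ * (s₀ + σ * ((k : ℚ) - 1))
      = (σ * (1 + c + Δ * ((k : ℚ) - 2)) - (σ - β) * (1 - Δ)) + Δ * (s₀ + β) := by ring
  rw [key]
  have : 0 ≤ Δ * (s₀ + β) := mul_nonneg hΔ0 hs
  linarith

end Summit.CriticalPhenomena.PercolationContinuityZ3.Theorems.CSH
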